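import Summits.QuantumFields.YangMills.Theorems.BalabanUVNodesN08AtRecord13CoPLaneFamily
import Summits.QuantumFields.YangMills.Theorems.BalabanUVNodesN08AlphaProfileSUEnd
import Literature.MathematicalPhysics.QuantumFieldTheory.Balaban1983to89.B10LeafUnpinnedRecord5C

/-!
# v1.5 `CoP` EDITION — director-ym LINE №160 ∕ №162 ((y) FINAL, EDITION FREEZE): RECORD 13 re-seeded at print's COLLAR-ranged background class (node00-def-R FILE 22′
# `LargeFieldBackgroundCoPOfRecord`, `UbgMSCoPOfRecord`) and the collar-exempt 𝐓-weights (def-T 12a″); def-T FILE 23 `Node00/Record13CoP` (p520810) + 24T `Node00/Record13SepCoP`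
# (p521293), token tables KEY-23 ∕ KEY-24T = «the v1.4 names with `Co ↦ CoP`» (`toStage5₁₃CoP`, `datumOfRecord₁₃CoP`, `IsRecordOfRecord₁₃CCoP`, `Provisos₁₃SepCoP`, `datumOfRecord₁₃SepCoP`,
# `IsRecordOfRecord₁₃CSepCoP(.toCoP)`; `Provisos₁₃Core` token-identical), dag-n10-d's CoP carrier leaves `Node00/Record13CarriersCoP ∕ Record13CarriersSepCoP` (`toStage5₁₃CoP_pin<G> ∕ _rebindX`,
# `view₁₃CoPB10YZW(_eq)`, `datumOfRecord₁₃(Sep)CoP_pin<G>`, `isRecordOfRecord₁₃C(Sep)CoP_pinB10_of_eq ∕ _rebindX_of_eq`, `exists_world_isRecordOfRecord₁₃CCoP_rebindX`).  THIS FILE is the verbatim token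
# image (of the Co-keyed draft `BalabanUVNodesN08AtRecord13CoLaneXeOf` (INTENT-4 l.18681, pre-staged d7f44216580a7cec, NOT filed at v1.4 — filed ONCE here)) under that table (generator `tools/cop_n08_gen.py`); statement SHAPES and proofs identical up to the tokens; the source module stays as the v1.4 sibling.
#
# BalabanUVNodes ∕ N08 AT THE CoP-BACKGROUND STAGE-13 RECORD THROUGH THE RE-BOUND [B10] LAYER AT dag-n08-d's CHOSEN EXTERNAL INPUTS `XeOf` — THE (α) CLAUSE
# WITH ITS IN-EDGE SIDE EMPTY, KNIT INTO THE RECORD: N08's lane conjunct at a `IsRecordOfRecord₁₃CCoP` record from `θ`'s Core provisos ∕ admissibility ∕ guard and the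
# cluster-expansion DATA SCHEMA at `XeOf` ALONE (generic gauge group `G` with a direction `X ∈ 𝔤 ∖ 0` and the size condition `4π ≤ C68`; for `SU(N)`, `N ≥ 2`, at the
# bumped constants `bump68 𝔠₀` with NO structural hypothesis) — dag-n08-d g5's record-free END forms `BalabanUVNodesN08AlphaProfileRecord.b10_main_upC_XeOf` (F9) ∕
# `…ProfileGroupSU` (F10: `suDir`) ∕ `…ProfileConsts` (F11: `four_pi_le_regMin_bump68`) ∕ `…ProfileSUEnd` (F12, p514827) composed BY NAME with dag-n10-d's CoP re-binding face
# `Node00.exists_world_isRecordOfRecord₁₃CCoP_rebindX` (CoP image of FILE 4) and def-T's C-binding identity `Node00.upOfRecord₅C_eq` (Track A, DAG node N08 [Balaban1985UV3] CMP **102**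
# (1985) 255, Thm 1 p. 257 (compact reading) + Thm 2 p. 272; R134 fan-out seat `pub-ymgap-dag-n08-c` g15, strategy s2 «knit `B10Assembly` at the record of record by name»;
# HANDOFF trigger (t17″): «an n08-d END form with structural hypotheses only ⇒ compose it into the lane storey», 2026-08-27)

WHY THIS FILE.  This seat's lane storeys (`…N08AtRecord13CoPLaneFamily` §3, `…CoLaneProfile`) present N08's conjunct of a Core-keyed Stage-13 nodes-∃ at a record whose [B10]
layer is re-bound to dag-n08-d's constructed d = 3 family, from the DATA schema AND in-edge hypotheses: the three faces `InEdgeFaces₃` (`…CoLaneFamily` §3) or the regular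
`h`-large profiles (b11‴) with kinematic choices (`…CoLaneProfile`).  dag-n08-d's g5 chain F8–F12 has since DISCHARGED the whole in-edge side: for ANY base inputs `X₀` with the
standard averaging, a parameter `w`, bond sets `Bk`, a direction `X ∈ 𝔤 ∖ 0` and the size condition `4π ≤ (regMin 𝔠).C68` it CHOOSES external inputs `XeOf 𝔊 𝔠 X₀ hstd w hX hX0 hC Bk`
(a definition, F9) and proves N08 BY NAME at every world whose upstream block is the C-binding `ofPrintedAllXPNC (Xc.withTowerRuns10 (S ↦ towerOf 𝔠.lane (XeOf … S) (𝔖 S))) Y Z V W`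
from the DATA schema `RunDataRows` at `XeOf` on the family `g²ε₀ ≤ (min γ_N08^d 1)²` ALONE (`b10_main_upC_XeOf`); for `G = SU(N)`, `N ≥ 2` the direction is `suDir` (F10) and the
size condition is met by `bump68 𝔠₀` (F11 ∕ F12) — NO structural hypothesis left.  Those END forms are record-free (`Rec` generic ∕ a pointed `hup`); they had no consumer at a
Stage-13 record.  HERE they are knit into the CoP record of RECORD 13: the C-binding of record over the CoP Stage-5 view of the RE-BOUND parameters `θ.rebindX (P ↦ (θ.res.X
P).withTowerRuns10 (lane family at XeOf))` IS such an `ofPrintedAllXPNC` word — `Node00.upOfRecord₅C_eq` (`rfl`) with `Xc := carriers₃ θ.toStage3Params (θ.res.X P)` (the Stage-3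
substitutions commute with re-binding the B10 group, `rfl`) and `Y Z V W` the view's residual layers — so n10-d's `exists_world_isRecordOfRecord₁₃CCoP_rebindX` supplies the record
and n08-d's closer supplies N08 at every run.

WHAT IS PROVED (kernel bookkeeping BY NAME; 0 `def`, 0 `sorry`; the `rfl` glue «Stage-3 substitutions commute with re-binding the B10 group» and «the C-binding of record over a
tower-run residual carrier IS `ofPrintedAllXPNC ((carriers₃ σ₃ Xc).withTowerRuns10 T) (Y P) (Z P) (V P) (W P)`» is CITED from `B10LeafUnpinnedRecord5C` §4 (`carriers₃_withTowerRuns10`,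
`upOfRecord₅C_eq_of_towerRuns`), with n10-d's `Stage13Params.toStage5₁₃CoP_rebindX`).
* §1 generic `G`: ★ `exists_world₁₃CCoP_laneXeOf_b10_main_of_data` — from `θ`, `h : θ.Provisos₁₃Core F N`, admissibility, the lane letters `(𝔊, 𝔠, hC, X, hX, hX0, X₀, hstd, w, Bk)`
  at block size `θ.L`, expansion ∕ auxiliary data `𝔖 ∕ 𝔄 ∕ coef` and THE DATA SCHEMA AT `XeOf` on the window: a world (any window height `γw`, block size `θ.L`) that IS a
  ₁₃CCoP record of `datumOfRecord₁₃CoP F N θ h`, bound over the CoP view of `θ.rebindX (lane family at XeOf)`, with `Dag.B10_main (leavesP w P)` at every run;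
  ★ `exists_guarded_record₁₃CCoP_laneXeOf_b10_main_of_data` — N08's conjunct shape of a Core-keyed `NodesAtSomeRecord13`, witnessed AT `θ` (guard ∕ admissibility at `θ`);
  ★ `exists_guarded_record₁₃CCoP_laneXeOf_b10_main_of_inhabited13Core` — «Core-keyed inhabitation `∃ θ, Provisos₁₃Core ∧ guard ∧ Admissible` + AT EVERY ODD `L > 1` lane letters
  with the DATA schema at `XeOf` ⟹ N08's conjunct» (the (α) programme's displayed inputs in place of the slot socket of `…N08AtRecord13CoP` §2 — now WITHOUT any in-edge face).
* §2 `G = SU(M)`, `M ≥ 2`, at `bump68 𝔠₀` (direction `suDir`, size condition a theorem): ★★ `exists_world₁₃CCoP_laneXeOf_b10_main_of_data_su_bump`,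
  ★★ `exists_guarded_record₁₃CCoP_laneXeOf_b10_main_of_data_su_bump`, ★★ `…_of_inhabited13Core_su_bump` (+ `_two`: the record's own group `N = 2` on the T⁴ side AND the lane
  group `SU(2)`).
* §3 ★★ `…_at_theta13LiveOfNumerics_of_data_su_bump` — K0a's all-numerics member (block size `F.L`), Core provisos OPAQUE, guard = K0a's HYPOTHESIS-FREE row P12, lane `SU(2)`.
HONEST FRAMING — PLEASE READ.  The re-bound [B10] layer is THE LANE'S constructed family at n08-d's chosen inputs `XeOf` (standard averaging, the lane's exact Haar-compatibility
field), NOT print's run family of record along `avOfPrint` (`runsB10OfRecord`, the `pinB10` layer) — hence NOT an inhabitant of the slot of record `Node00.PrintedUV3V N θ.L` and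
NOT a re-pointing of S1; whether N08's COUNT may be read at such a record is the chair's species word (seam E6′, R451 ∕ R454).  The cluster-expansion DATA SCHEMA `RunDataRows` at
`XeOf` (the [B10] §§2–3 ∕ [8]–[10] expansion — class II of the n08-b census, THE object gap of N08 in data form), the Core provisos, admissibility, the guard, the signs and every
window inequality are DISPLAYED hypotheses; `XeOf` is n08-d's DEFINITION (a choice of minimisers), not data of print; nothing of Bałaban's asserted; K0 ∕ K1 neither proved nor
assumed; N08 NOT discharged; count-neutral; one finite four-torus per run at fixed `ε`, the lane's d = 3 tori inside the record; nothing continuum ∕ ℝ⁴ ∕ OS ∕ mass gap ∕ Clay.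
Sources: [Balaban1985UV3] Thm 1 p.257 (compact reading), Thm 2 p.272, (41)–(42) p.266, (44) p.267, (67)–(68) p.273, p.256 L15–18; [Balaban1985Variational] Thm 1 p.279;
[Balaban1985Averaging] Prop. 2 (54) p.26; [Balaban1989LargeFieldII] Thm 1 + (0.1) pp.355–356; [Balaban1988Convergent] p.244, (2.18) p.257, (3.16)–(3.22) pp.268–269;
[Balaban1987RG1] Thm 1 p.255; [Balaban1984PropagatorsII] pp.223–250 (the Stage-3 carriers).
-/

noncomputable section

namespace Summit.QuantumFields.YangMills.BalabanUVNodes.N08AtRecord13CoPLaneXeOf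

open MeasureTheory
open scoped BigOperators Matrix Matrix.Norms.L2Operator
open Literature.MathematicalPhysics.QuantumFieldTheory.Balaban1983to89
open Literature.MathematicalPhysics.QuantumFieldTheory.Balaban1983to89.B10
open Literature.MathematicalPhysics.QuantumFieldTheory.Balaban1983to89.B10SectCExpansion (TermSizes)
open Literature.MathematicalPhysics.QuantumFieldTheory.Balaban1985CMP102
open Literature.MathematicalPhysics.QuantumFieldTheory.Balaban1985CMP102.Setting
open Literature.MathematicalPhysics.QuantumFieldTheory.Balaban1983to89.T4Continuum (T4Family FiniteEpsData)
open Literature.MathematicalPhysics.QuantumFieldTheory.Balaban1983to89.DagBinding (leavesP WorldP PrintedCarriersR PrintedCarriers9X PrintedCarriers11 PrintedCarriers14R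
  PrintedCarriers15)
open Literature.MathematicalPhysics.QuantumFieldTheory.Balaban1983to89.B10CompactBinding (ofPrintedAllXPNC)
open Literature.MathematicalPhysics.QuantumFieldTheory.Balaban1983to89.Node00
open Summit.QuantumFields.Balaban3D.Carriers
open Summit.QuantumFields.Balaban3D.Proofs.Inputs
open Summit.QuantumFields.Balaban3D.Proofs.Primitives (AlphaConsts)
open Summit.QuantumFields.Balaban3D.Proofs.GroupModelLieC (lieC)
open Summit.QuantumFields.Balaban3D.Proofs.UVStability3DInputs
open Summit.QuantumFields.Balaban3D.Proofs.FamilyLE (ScalesLE)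
open Summit.QuantumFields.YangMills.Theorems.BalabanUVNodesN08AlphaClassI
open Summit.QuantumFields.YangMills.Theorems.BalabanUVNodesN08AlphaLoop28
open Summit.QuantumFields.YangMills.Theorems.BalabanUVNodesN08AlphaThreeFaces (regMin)
open Summit.QuantumFields.YangMills.Theorems.BalabanUVNodesN08AlphaProfileThreshold
open Summit.QuantumFields.YangMills.Theorems.BalabanUVNodesN08AlphaProfileRecord
open Summit.QuantumFields.YangMills.Theorems.BalabanUVNodesN08AlphaProfileGroupSU
open Summit.QuantumFields.YangMills.Theorems.BalabanUVNodesN08AlphaProfileConsts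
open Summit.QuantumFields.YangMills.BalabanUVNodes.N08AtRecord13CoP

variable {F : T4Family} {N : ℕ} [NeZero N]

/-! ## §1 GENERIC GAUGE GROUP: N08 AT THE CoP RECORD FROM THE DATA SCHEMA AT `XeOf` ALONE -/

section Generic
variable {G : Type} [GaugeGroup G] [MeasurableSpace G] [HaarData G] (𝔊 : GroupModel G)

/-- **★ A ₁₃CCoP RECORD OF `datumOfRecord₁₃CoP F N θ h` BOUND OVER THE CoP VIEW OF THE LANE-RE-BOUND PARAMETERS AT `XeOf`, CARRYING N08 AT EVERY RUN, FROM THE DATA SCHEMA AT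
`XeOf` ALONE** (any window `γw`, block size `θ.L`): lane letters `𝔠` with `4π ≤ (regMin 𝔠).C68`, a direction `X ∈ 𝔤 ∖ 0`, base inputs `X₀` with the standard averaging, `w`, `Bk`;
expansion data `𝔖`, auxiliary data `𝔄`, sizes `coef`; DISPLAYED: `RunDataRows` at `XeOf …` on the window `g²ε₀ ≤ (min γ_N08^d 1)²`.  World by n10-d's
`exists_world_isRecordOfRecord₁₃CCoP_rebindX`; N08 by n08-d's `b10_main_upC_XeOf` at the `ofPrintedAllXPNC` word the record's world unfolds to (`B10LeafUnpinnedRecord5C.upOfRecord₅C_eq_of_towerRuns`) — NO in-edge hypothesis. [cite: Balaban1985UV3, Thm 1 p.257 (compact reading) + Thm 2 p.272 + (41)–(42) p.266 + (67)–(68) p.273; Balaban1985Variational, Thm 1 p.279; Balaban1985Averaging, Prop. 2 (54) p.26; Balaban1989LargeFieldII, Thm 1 + (0.1) pp.355–356 (bookkeeping)] -/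
theorem exists_world₁₃CCoP_laneXeOf_b10_main_of_data (θ : Stage13Params F N) (h : θ.Provisos₁₃Core F N) (hθ : θ.Admissible F N)
    (𝔠 : AlphaConsts θ.L 𝔊.N) (hC : 4 * Real.pi ≤ (regMin 𝔠).C68) {X : Matrix (Fin 𝔊.N) (Fin 𝔊.N) ℂ} (hX : X ∈ 𝔊.lie) (hX0 : X ≠ 0)
    (X₀ : ∀ S : Scales θ.L, ExternalInputs S G) (hstd : ∀ S : Scales θ.L, (X₀ S).av = AveragingRT.stdAvg S.P G) (w : ℝ)
    (Bk : ∀ (S : Scales θ.L) (k : ℕ), Hist S.P k → Set (PBond S.P k))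
    (𝔖 : ∀ (S : Scales θ.L) (k : ℕ), StepSeries S G ↥(lieC 𝔊) (nblkOf S 𝔠.lane.carrier k) k)
    (𝔄 : ∀ S : Scales θ.L, AlphaData 𝔊 𝔠 (XeOf 𝔊 𝔠 X₀ hstd w hX hX0 hC Bk S) (𝔖 S))
    (coef : ∀ (S : Scales θ.L) (k : ℕ), Hist S.P (k + 1) → GaugeField S.P (k + 1) G → (j : ℕ) → TermSizes (oldGeom S.P k j))
    (hD : ∀ S : Scales θ.L, S.g ^ 2 * S.ε₀ ≤ (min (gammaN08d 𝔠) 1) ^ 2 →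
      RunDataRows 𝔊 𝔠 (XeOf 𝔊 𝔠 X₀ hstd w hX hX0 hC Bk S) (𝔖 S) (𝔄 S) (sizesOf 𝔊 𝔠 (XeOf 𝔊 𝔠 X₀ hstd w hX hX0 hC Bk S) (coef S)))
    {γw : ℝ} (hγw : 0 < γw ∧ γw ≤ θ.γ) :
    ∃ w' : WorldP, IsRecordOfRecord₁₃CCoP F N (datumOfRecord₁₃CoP F N θ h) w' ∧ w'.γ = γw ∧ w'.L = (θ.L : ℝ) ∧
      (∀ P, w'.up P = upOfRecord₅C F N ((θ.rebindX F N fun P => (θ.res.X P).withTowerRuns10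
        fun S : ScalesLE θ.L ((min (gammaN08d 𝔠) 1) ^ 2) => towerOf 𝔠.lane (XeOf 𝔊 𝔠 X₀ hstd w hX hX0 hC Bk S.1) (𝔖 S.1)).toStage5₁₃CoP F N) P) ∧
      ∀ P : B12.RunParams, Dag.B10_main (leavesP w' P) := by
  obtain ⟨w', hR, hγ, hL, hup⟩ := exists_world_isRecordOfRecord₁₃CCoP_rebindX F N θ h hθ
    (fun P => (θ.res.X P).withTowerRuns10
      fun S : ScalesLE θ.L ((min (gammaN08d 𝔠) 1) ^ 2) => towerOf 𝔠.lane (XeOf 𝔊 𝔠 X₀ hstd w hX hX0 hC Bk S.1) (𝔖 S.1)) hγw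
  refine ⟨w', hR, hγ, hL, hup, fun P => ?_⟩
  -- the record's world IS n08-d's `ofPrintedAllXPNC` word (n10-d's `toStage5₁₃CoP_rebindX` + `B10LeafUnpinnedRecord5C.upOfRecord₅C_eq_of_towerRuns`, both `rfl`
  -- bookkeeping), so n08-d's record-free closer applies at it
  have hup' := (hup P).trans (((congrArg (fun σ => upOfRecord₅C F N σ P) (Stage13Params.toStage5₁₃CoP_rebindX F N θ _))).trans
    (B10LeafUnpinnedRecord5C.upOfRecord₅C_eq_of_towerRuns _ P (θ.res.X P) _ rfl))
  exact b10_main_upC_XeOf 𝔊 𝔠 X₀ hstd w hX hX0 hC Bk 𝔖 𝔄 coef _ _ _ _ _ w' P hD hup'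

/-- **★ N08's CONJUNCT SHAPE OF A CORE-KEYED `NodesAtSomeRecord13`, WITNESSED AT `θ`, FROM THE DATA SCHEMA AT `XeOf` ALONE** (plus `θ`'s Core provisos, admissibility and guard;
the presenting re-bound parameter is inside the ∃ of `IsRecordOfRecord₁₃CCoP`). [cite: Balaban1985UV3, Thm 1 p.257 (compact reading) + Thm 2 p.272; Balaban1989LargeFieldII, Thm 1 + (0.1) pp.355–356; Balaban1988Convergent, (3.16)–(3.22) pp.268–269 (bookkeeping)] -/
theorem exists_guarded_record₁₃CCoP_laneXeOf_b10_main_of_data (θ : Stage13Params F N) (h : θ.Provisos₁₃Core F N) (hθ : θ.Admissible F N)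
    (hG : θ.ZtUnity F N ∧ θ.SlotsNondegenerate₁₃ F N)
    (𝔠 : AlphaConsts θ.L 𝔊.N) (hC : 4 * Real.pi ≤ (regMin 𝔠).C68) {X : Matrix (Fin 𝔊.N) (Fin 𝔊.N) ℂ} (hX : X ∈ 𝔊.lie) (hX0 : X ≠ 0)
    (X₀ : ∀ S : Scales θ.L, ExternalInputs S G) (hstd : ∀ S : Scales θ.L, (X₀ S).av = AveragingRT.stdAvg S.P G) (w : ℝ)
    (Bk : ∀ (S : Scales θ.L) (k : ℕ), Hist S.P k → Set (PBond S.P k))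
    (𝔖 : ∀ (S : Scales θ.L) (k : ℕ), StepSeries S G ↥(lieC 𝔊) (nblkOf S 𝔠.lane.carrier k) k)
    (𝔄 : ∀ S : Scales θ.L, AlphaData 𝔊 𝔠 (XeOf 𝔊 𝔠 X₀ hstd w hX hX0 hC Bk S) (𝔖 S))
    (coef : ∀ (S : Scales θ.L) (k : ℕ), Hist S.P (k + 1) → GaugeField S.P (k + 1) G → (j : ℕ) → TermSizes (oldGeom S.P k j))
    (hD : ∀ S : Scales θ.L, S.g ^ 2 * S.ε₀ ≤ (min (gammaN08d 𝔠) 1) ^ 2 →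
      RunDataRows 𝔊 𝔠 (XeOf 𝔊 𝔠 X₀ hstd w hX hX0 hC Bk S) (𝔖 S) (𝔄 S) (sizesOf 𝔊 𝔠 (XeOf 𝔊 𝔠 X₀ hstd w hX hX0 hC Bk S) (coef S))) :
    ∃ (θ' : Stage13Params F N) (h' : θ'.Provisos₁₃Core F N) (w' : WorldP), (θ'.ZtUnity F N ∧ θ'.SlotsNondegenerate₁₃ F N) ∧ θ'.Admissible F N ∧
      IsRecordOfRecord₁₃CCoP F N (datumOfRecord₁₃CoP F N θ' h') w' ∧ ∀ P : B12.RunParams, Dag.B10_main (leavesP w' P) := by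
  obtain ⟨w', hR, -, -, -, hN⟩ := exists_world₁₃CCoP_laneXeOf_b10_main_of_data 𝔊 θ h hθ 𝔠 hC hX hX0 X₀ hstd w Bk 𝔖 𝔄 coef hD
    ⟨hθ.toStage9.gamma_pos, le_rfl⟩
  exact ⟨θ, h, w', hG, hθ, hR, hN⟩

/-- **★ «A CORE-KEYED INHABITATION ⟹ N08's CONJUNCT OF A CORE-KEYED STAGE-13 NODES-∃» FROM THE DATA SCHEMA AT `XeOf` ALONE, generic `N` and `G`**: from `∃ θ, Provisos₁₃Core ∧
(ZtUnity ∧ SlotsNondegenerate₁₃) ∧ Admissible` at `F` (HYPOTHESIS `hI`) and, AT EVERY ODD BLOCK SIZE `L > 1`, lane letters `(𝔠, hC, X, hX, hX0, X₀, hstd, w, Bk, 𝔖, 𝔄, coef)` with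
the DATA SCHEMA at `XeOf` on the window (HYPOTHESIS `hlane` — the (α) programme's displayed inputs, NO in-edge face) ⟹ N08's conjunct.  NOT the stub, NOT a discharge; the
[B10] layer is the lane's, not print's (module docstring). [cite: Balaban1985UV3, Thm 1 p.257 (compact reading) + Thm 2 p.272 + p.256 L15–18; Balaban1989LargeFieldII, Thm 1 + (0.1) pp.355–356 (bookkeeping)] -/
theorem exists_guarded_record₁₃CCoP_laneXeOf_b10_main_of_inhabited13Core
    (hI : ∃ θ : Stage13Params F N, θ.Provisos₁₃Core F N ∧ (θ.ZtUnity F N ∧ θ.SlotsNondegenerate₁₃ F N) ∧ θ.Admissible F N)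
    (hlane : ∀ L : ℕ, Odd L → 1 < L →
      ∃ (𝔠 : AlphaConsts L 𝔊.N) (hC : 4 * Real.pi ≤ (regMin 𝔠).C68) (X : Matrix (Fin 𝔊.N) (Fin 𝔊.N) ℂ) (hX : X ∈ 𝔊.lie) (hX0 : X ≠ 0)
        (X₀ : ∀ S : Scales L, ExternalInputs S G) (hstd : ∀ S : Scales L, (X₀ S).av = AveragingRT.stdAvg S.P G) (w : ℝ)
        (Bk : ∀ (S : Scales L) (k : ℕ), Hist S.P k → Set (PBond S.P k))
        (𝔖 : ∀ (S : Scales L) (k : ℕ), StepSeries S G ↥(lieC 𝔊) (nblkOf S 𝔠.lane.carrier k) k)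
        (𝔄 : ∀ S : Scales L, AlphaData 𝔊 𝔠 (XeOf 𝔊 𝔠 X₀ hstd w hX hX0 hC Bk S) (𝔖 S))
        (coef : ∀ (S : Scales L) (k : ℕ), Hist S.P (k + 1) → GaugeField S.P (k + 1) G → (j : ℕ) → TermSizes (oldGeom S.P k j)),
        ∀ S : Scales L, S.g ^ 2 * S.ε₀ ≤ (min (gammaN08d 𝔠) 1) ^ 2 →
          RunDataRows 𝔊 𝔠 (XeOf 𝔊 𝔠 X₀ hstd w hX hX0 hC Bk S) (𝔖 S) (𝔄 S) (sizesOf 𝔊 𝔠 (XeOf 𝔊 𝔠 X₀ hstd w hX hX0 hC Bk S) (coef S))) :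
    ∃ (θ : Stage13Params F N) (h : θ.Provisos₁₃Core F N) (w' : WorldP), (θ.ZtUnity F N ∧ θ.SlotsNondegenerate₁₃ F N) ∧ θ.Admissible F N ∧
      IsRecordOfRecord₁₃CCoP F N (datumOfRecord₁₃CoP F N θ h) w' ∧ ∀ P : B12.RunParams, Dag.B10_main (leavesP w' P) := by
  obtain ⟨θ, h, hG, hθ⟩ := hI
  obtain ⟨𝔠, hC, X, hX, hX0, X₀, hstd, w, Bk, 𝔖, 𝔄, coef, hD⟩ := hlane θ.L θ.hL.1 θ.hL.2
  exact exists_guarded_record₁₃CCoP_laneXeOf_b10_main_of_data 𝔊 θ h hθ hG 𝔠 hC hX hX0 X₀ hstd w Bk 𝔖 𝔄 coef hD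

end Generic

/-! ## §2 `G = SU(N)`, `N ≥ 2`, AT THE BUMPED CONSTANTS `bump68 𝔠₀` — direction `suDir`, size condition a theorem (`four_pi_le_regMin_bump68`): NO structural hypothesis -/

section SU
variable {M : ℕ} [NeZero M]

/-- **★★ `SU(M)`, `M ≥ 2`: A ₁₃CCoP RECORD OF `datumOfRecord₁₃CoP F N θ h` BOUND OVER THE CoP VIEW OF THE LANE-RE-BOUND PARAMETERS AT `XeOf` (lane group `SU(M)`, constants `bump68 𝔠₀`,
direction `suDir`), CARRYING N08 AT EVERY RUN — from base inputs `X₀` (standard averaging), `w`, `Bk`, data `𝔖 ∕ 𝔄 ∕ coef` and THE DATA SCHEMA AT `XeOf` ALONE** (any window `γw`,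
block size `θ.L`). [cite: Balaban1985UV3, Thm 1 p.257 (compact reading) + Thm 2 p.272 + (41)–(42) p.266 + (67)–(68) p.273; Balaban1985Variational, Thm 1 p.279; Balaban1989LargeFieldII, Thm 1 + (0.1) pp.355–356 (bookkeeping)] -/
theorem exists_world₁₃CCoP_laneXeOf_b10_main_of_data_su_bump (hM : 2 ≤ M) (θ : Stage13Params F N) (h : θ.Provisos₁₃Core F N) (hθ : θ.Admissible F N)
    (𝔠₀ : AlphaConsts θ.L (suGroupModel M).N)
    (X₀ : ∀ S : Scales θ.L, ExternalInputs S (Matrix.specialUnitaryGroup (Fin M) ℂ))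
    (hstd : ∀ S : Scales θ.L, (X₀ S).av = AveragingRT.stdAvg S.P (Matrix.specialUnitaryGroup (Fin M) ℂ)) (w : ℝ)
    (Bk : ∀ (S : Scales θ.L) (k : ℕ), Hist S.P k → Set (PBond S.P k))
    (𝔖 : ∀ (S : Scales θ.L) (k : ℕ), StepSeries S (Matrix.specialUnitaryGroup (Fin M) ℂ) ↥(lieC (suGroupModel M)) (nblkOf S (bump68 𝔠₀).lane.carrier k) k)
    (𝔄 : ∀ S : Scales θ.L, AlphaData (suGroupModel M) (bump68 𝔠₀)
      (XeOf (suGroupModel M) (bump68 𝔠₀) X₀ hstd w (suDir_mem_su hM) (suDir_ne_zero hM) (four_pi_le_regMin_bump68 𝔠₀) Bk S) (𝔖 S))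
    (coef : ∀ (S : Scales θ.L) (k : ℕ), Hist S.P (k + 1) → GaugeField S.P (k + 1) (Matrix.specialUnitaryGroup (Fin M) ℂ) → (j : ℕ) → TermSizes (oldGeom S.P k j))
    (hD : ∀ S : Scales θ.L, S.g ^ 2 * S.ε₀ ≤ (min (gammaN08d (bump68 𝔠₀)) 1) ^ 2 →
      RunDataRows (suGroupModel M) (bump68 𝔠₀)
        (XeOf (suGroupModel M) (bump68 𝔠₀) X₀ hstd w (suDir_mem_su hM) (suDir_ne_zero hM) (four_pi_le_regMin_bump68 𝔠₀) Bk S) (𝔖 S) (𝔄 S)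
        (sizesOf (suGroupModel M) (bump68 𝔠₀)
          (XeOf (suGroupModel M) (bump68 𝔠₀) X₀ hstd w (suDir_mem_su hM) (suDir_ne_zero hM) (four_pi_le_regMin_bump68 𝔠₀) Bk S) (coef S)))
    {γw : ℝ} (hγw : 0 < γw ∧ γw ≤ θ.γ) :
    ∃ w' : WorldP, IsRecordOfRecord₁₃CCoP F N (datumOfRecord₁₃CoP F N θ h) w' ∧ w'.γ = γw ∧ w'.L = (θ.L : ℝ) ∧
      (∀ P, w'.up P = upOfRecord₅C F N ((θ.rebindX F N fun P => (θ.res.X P).withTowerRuns10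
        fun S : ScalesLE θ.L ((min (gammaN08d (bump68 𝔠₀)) 1) ^ 2) => towerOf (bump68 𝔠₀).lane
          (XeOf (suGroupModel M) (bump68 𝔠₀) X₀ hstd w (suDir_mem_su hM) (suDir_ne_zero hM) (four_pi_le_regMin_bump68 𝔠₀) Bk S.1) (𝔖 S.1)).toStage5₁₃CoP F N) P) ∧
      ∀ P : B12.RunParams, Dag.B10_main (leavesP w' P) :=
  exists_world₁₃CCoP_laneXeOf_b10_main_of_data (suGroupModel M) θ h hθ (bump68 𝔠₀) (four_pi_le_regMin_bump68 𝔠₀) (suDir_mem_su hM) (suDir_ne_zero hM)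
    X₀ hstd w Bk 𝔖 𝔄 coef hD hγw

/-- **★★ `SU(M)`, `M ≥ 2`: N08's CONJUNCT SHAPE OF A CORE-KEYED `NodesAtSomeRecord13`, WITNESSED AT `θ`, FROM THE DATA SCHEMA AT `XeOf` ALONE** (plus Core provisos, admissibility,
guard; constants `bump68 𝔠₀`, direction `suDir` — no structural hypothesis). [cite: Balaban1985UV3, Thm 1 p.257 (compact reading) + Thm 2 p.272; Balaban1989LargeFieldII, Thm 1 + (0.1) pp.355–356; Balaban1988Convergent, (3.16)–(3.22) pp.268–269 (bookkeeping)] -/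
theorem exists_guarded_record₁₃CCoP_laneXeOf_b10_main_of_data_su_bump (hM : 2 ≤ M) (θ : Stage13Params F N) (h : θ.Provisos₁₃Core F N) (hθ : θ.Admissible F N)
    (hG : θ.ZtUnity F N ∧ θ.SlotsNondegenerate₁₃ F N) (𝔠₀ : AlphaConsts θ.L (suGroupModel M).N)
    (X₀ : ∀ S : Scales θ.L, ExternalInputs S (Matrix.specialUnitaryGroup (Fin M) ℂ))
    (hstd : ∀ S : Scales θ.L, (X₀ S).av = AveragingRT.stdAvg S.P (Matrix.specialUnitaryGroup (Fin M) ℂ)) (w : ℝ)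
    (Bk : ∀ (S : Scales θ.L) (k : ℕ), Hist S.P k → Set (PBond S.P k))
    (𝔖 : ∀ (S : Scales θ.L) (k : ℕ), StepSeries S (Matrix.specialUnitaryGroup (Fin M) ℂ) ↥(lieC (suGroupModel M)) (nblkOf S (bump68 𝔠₀).lane.carrier k) k)
    (𝔄 : ∀ S : Scales θ.L, AlphaData (suGroupModel M) (bump68 𝔠₀)
      (XeOf (suGroupModel M) (bump68 𝔠₀) X₀ hstd w (suDir_mem_su hM) (suDir_ne_zero hM) (four_pi_le_regMin_bump68 𝔠₀) Bk S) (𝔖 S))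
    (coef : ∀ (S : Scales θ.L) (k : ℕ), Hist S.P (k + 1) → GaugeField S.P (k + 1) (Matrix.specialUnitaryGroup (Fin M) ℂ) → (j : ℕ) → TermSizes (oldGeom S.P k j))
    (hD : ∀ S : Scales θ.L, S.g ^ 2 * S.ε₀ ≤ (min (gammaN08d (bump68 𝔠₀)) 1) ^ 2 →
      RunDataRows (suGroupModel M) (bump68 𝔠₀)
        (XeOf (suGroupModel M) (bump68 𝔠₀) X₀ hstd w (suDir_mem_su hM) (suDir_ne_zero hM) (four_pi_le_regMin_bump68 𝔠₀) Bk S) (𝔖 S) (𝔄 S)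
        (sizesOf (suGroupModel M) (bump68 𝔠₀)
          (XeOf (suGroupModel M) (bump68 𝔠₀) X₀ hstd w (suDir_mem_su hM) (suDir_ne_zero hM) (four_pi_le_regMin_bump68 𝔠₀) Bk S) (coef S))) :
    ∃ (θ' : Stage13Params F N) (h' : θ'.Provisos₁₃Core F N) (w' : WorldP), (θ'.ZtUnity F N ∧ θ'.SlotsNondegenerate₁₃ F N) ∧ θ'.Admissible F N ∧
      IsRecordOfRecord₁₃CCoP F N (datumOfRecord₁₃CoP F N θ' h') w' ∧ ∀ P : B12.RunParams, Dag.B10_main (leavesP w' P) :=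
  exists_guarded_record₁₃CCoP_laneXeOf_b10_main_of_data (suGroupModel M) θ h hθ hG (bump68 𝔠₀) (four_pi_le_regMin_bump68 𝔠₀) (suDir_mem_su hM) (suDir_ne_zero hM)
    X₀ hstd w Bk 𝔖 𝔄 coef hD

/-- **★★ `SU(M)`, `M ≥ 2`: «A CORE-KEYED INHABITATION ⟹ N08's CONJUNCT OF A CORE-KEYED STAGE-13 NODES-∃» FROM THE DATA SCHEMA AT `XeOf` ALONE** — at every odd block size `L > 1`
lane letters `(𝔠₀, X₀ standard, w, Bk, 𝔖, 𝔄, coef)` with the DATA schema at `XeOf` on the window at the bumped constants; NO in-edge face, NO structural hypothesis.  NOT the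
stub, NOT a discharge. [cite: Balaban1985UV3, Thm 1 p.257 (compact reading) + Thm 2 p.272 + p.256 L15–18; Balaban1989LargeFieldII, Thm 1 + (0.1) pp.355–356 (bookkeeping)] -/
theorem exists_guarded_record₁₃CCoP_laneXeOf_b10_main_of_inhabited13Core_su_bump (hM : 2 ≤ M)
    (hI : ∃ θ : Stage13Params F N, θ.Provisos₁₃Core F N ∧ (θ.ZtUnity F N ∧ θ.SlotsNondegenerate₁₃ F N) ∧ θ.Admissible F N)
    (hlane : ∀ L : ℕ, Odd L → 1 < L →
      ∃ (𝔠₀ : AlphaConsts L (suGroupModel M).N) (X₀ : ∀ S : Scales L, ExternalInputs S (Matrix.specialUnitaryGroup (Fin M) ℂ))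
        (hstd : ∀ S : Scales L, (X₀ S).av = AveragingRT.stdAvg S.P (Matrix.specialUnitaryGroup (Fin M) ℂ)) (w : ℝ)
        (Bk : ∀ (S : Scales L) (k : ℕ), Hist S.P k → Set (PBond S.P k))
        (𝔖 : ∀ (S : Scales L) (k : ℕ), StepSeries S (Matrix.specialUnitaryGroup (Fin M) ℂ) ↥(lieC (suGroupModel M)) (nblkOf S (bump68 𝔠₀).lane.carrier k) k)
        (𝔄 : ∀ S : Scales L, AlphaData (suGroupModel M) (bump68 𝔠₀)
          (XeOf (suGroupModel M) (bump68 𝔠₀) X₀ hstd w (suDir_mem_su hM) (suDir_ne_zero hM) (four_pi_le_regMin_bump68 𝔠₀) Bk S) (𝔖 S))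
        (coef : ∀ (S : Scales L) (k : ℕ), Hist S.P (k + 1) → GaugeField S.P (k + 1) (Matrix.specialUnitaryGroup (Fin M) ℂ) → (j : ℕ) → TermSizes (oldGeom S.P k j)),
        ∀ S : Scales L, S.g ^ 2 * S.ε₀ ≤ (min (gammaN08d (bump68 𝔠₀)) 1) ^ 2 →
          RunDataRows (suGroupModel M) (bump68 𝔠₀)
            (XeOf (suGroupModel M) (bump68 𝔠₀) X₀ hstd w (suDir_mem_su hM) (suDir_ne_zero hM) (four_pi_le_regMin_bump68 𝔠₀) Bk S) (𝔖 S) (𝔄 S)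
            (sizesOf (suGroupModel M) (bump68 𝔠₀)
              (XeOf (suGroupModel M) (bump68 𝔠₀) X₀ hstd w (suDir_mem_su hM) (suDir_ne_zero hM) (four_pi_le_regMin_bump68 𝔠₀) Bk S) (coef S))) :
    ∃ (θ : Stage13Params F N) (h : θ.Provisos₁₃Core F N) (w' : WorldP), (θ.ZtUnity F N ∧ θ.SlotsNondegenerate₁₃ F N) ∧ θ.Admissible F N ∧
      IsRecordOfRecord₁₃CCoP F N (datumOfRecord₁₃CoP F N θ h) w' ∧ ∀ P : B12.RunParams, Dag.B10_main (leavesP w' P) := by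
  obtain ⟨θ, h, hG, hθ⟩ := hI
  obtain ⟨𝔠₀, X₀, hstd, w, Bk, 𝔖, 𝔄, coef, hD⟩ := hlane θ.L θ.hL.1 θ.hL.2
  exact exists_guarded_record₁₃CCoP_laneXeOf_b10_main_of_data_su_bump hM θ h hθ hG 𝔠₀ X₀ hstd w Bk 𝔖 𝔄 coef hD

/-- **★★ THE SAME AT THE GROUPS OF RECORD: the T⁴ side at `N = 2`** (hypothesis `hI` = the Core-keyed inhabitation text at `F 2`) **and the lane at `SU(2)`** (`M = 2`).
[cite: Balaban1985UV3, Thm 1 p.257 (compact reading) + Thm 2 p.272; Balaban1989LargeFieldII, Thm 1 + (0.1) pp.355–356 (bookkeeping)] -/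
theorem exists_guarded_record₁₃CCoP_laneXeOf_b10_main_of_inhabited13Core_su_bump_two (F : T4Family)
    (hI : ∃ θ : Stage13Params F 2, θ.Provisos₁₃Core F 2 ∧ (θ.ZtUnity F 2 ∧ θ.SlotsNondegenerate₁₃ F 2) ∧ θ.Admissible F 2)
    (hlane : ∀ L : ℕ, Odd L → 1 < L →
      ∃ (𝔠₀ : AlphaConsts L (suGroupModel 2).N) (X₀ : ∀ S : Scales L, ExternalInputs S (Matrix.specialUnitaryGroup (Fin 2) ℂ))
        (hstd : ∀ S : Scales L, (X₀ S).av = AveragingRT.stdAvg S.P (Matrix.specialUnitaryGroup (Fin 2) ℂ)) (w : ℝ)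
        (Bk : ∀ (S : Scales L) (k : ℕ), Hist S.P k → Set (PBond S.P k))
        (𝔖 : ∀ (S : Scales L) (k : ℕ), StepSeries S (Matrix.specialUnitaryGroup (Fin 2) ℂ) ↥(lieC (suGroupModel 2)) (nblkOf S (bump68 𝔠₀).lane.carrier k) k)
        (𝔄 : ∀ S : Scales L, AlphaData (suGroupModel 2) (bump68 𝔠₀)
          (XeOf (suGroupModel 2) (bump68 𝔠₀) X₀ hstd w (suDir_mem_su le_rfl) (suDir_ne_zero le_rfl) (four_pi_le_regMin_bump68 𝔠₀) Bk S) (𝔖 S))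
        (coef : ∀ (S : Scales L) (k : ℕ), Hist S.P (k + 1) → GaugeField S.P (k + 1) (Matrix.specialUnitaryGroup (Fin 2) ℂ) → (j : ℕ) → TermSizes (oldGeom S.P k j)),
        ∀ S : Scales L, S.g ^ 2 * S.ε₀ ≤ (min (gammaN08d (bump68 𝔠₀)) 1) ^ 2 →
          RunDataRows (suGroupModel 2) (bump68 𝔠₀)
            (XeOf (suGroupModel 2) (bump68 𝔠₀) X₀ hstd w (suDir_mem_su le_rfl) (suDir_ne_zero le_rfl) (four_pi_le_regMin_bump68 𝔠₀) Bk S) (𝔖 S) (𝔄 S)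
            (sizesOf (suGroupModel 2) (bump68 𝔠₀)
              (XeOf (suGroupModel 2) (bump68 𝔠₀) X₀ hstd w (suDir_mem_su le_rfl) (suDir_ne_zero le_rfl) (four_pi_le_regMin_bump68 𝔠₀) Bk S) (coef S))) :
    ∃ (θ : Stage13Params F 2) (h : θ.Provisos₁₃Core F 2) (w' : WorldP), (θ.ZtUnity F 2 ∧ θ.SlotsNondegenerate₁₃ F 2) ∧ θ.Admissible F 2 ∧
      IsRecordOfRecord₁₃CCoP F 2 (datumOfRecord₁₃CoP F 2 θ h) w' ∧ ∀ P : B12.RunParams, Dag.B10_main (leavesP w' P) :=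
  exists_guarded_record₁₃CCoP_laneXeOf_b10_main_of_inhabited13Core_su_bump le_rfl hI hlane

end SU

/-! ## §3 ON K0a's ALL-NUMERICS WITNESS FAMILY `θL F n ε₂₉ = theta13LiveOfNumerics F 2 n ε₂₉ …` (block size `F.L` by `rfl`), CORE PROVISOS OPAQUE, lane `SU(2)` at `bump68 𝔠₀` -/

section Numerics

/-- **★★ N08's CONJUNCT OF A CORE-KEYED ₁₃ NODES-∃ AT `N = 2`, WITNESSED AT THE MEMBER `θL F n ε₂₉`, FROM THE DATA SCHEMA AT `XeOf` ALONE** (lane `SU(2)`, constants `bump68 𝔠₀`,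
block size `F.L`): from `n.Pos`, `0 < ε₂₉`, the member's Core provisos `hP` (HYPOTHESIS, opaque), base inputs `X₀` (standard averaging), `w`, `Bk`, data `𝔖 ∕ 𝔄 ∕ coef` and
`RunDataRows` at `XeOf` on the window — guard and admissibility at `θL` are K0a's theorems BY NAME (HYPOTHESIS-FREE row P12). [cite: Balaban1985UV3, Thm 1 p.257 (compact reading) + Thm 2 p.272; Balaban1988Convergent, (3.16)–(3.22) pp.268–269; Balaban1987RG1, Thm 1 p.255 (bookkeeping)] -/
theorem exists_guarded_record₁₃CCoP_laneXeOf_b10_main_at_theta13LiveOfNumerics_of_data_su_bump (F : T4Family) {n : Stage12Numerics} {ε₂₉ : ℝ} (hn : n.Pos)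
    (hε' : 0 < ε₂₉) (hP : (theta13LiveOfNumerics F 2 n ε₂₉ (zeta316OfRecord F 2 n.ν n.τ9.M n.A₁) (RzOfRecord F 2) (ZtOfRecord F 2)).Provisos₁₃Core F 2)
    (𝔠₀ : AlphaConsts F.L (suGroupModel 2).N) (X₀ : ∀ S : Scales F.L, ExternalInputs S (Matrix.specialUnitaryGroup (Fin 2) ℂ))
    (hstd : ∀ S : Scales F.L, (X₀ S).av = AveragingRT.stdAvg S.P (Matrix.specialUnitaryGroup (Fin 2) ℂ)) (w : ℝ)
    (Bk : ∀ (S : Scales F.L) (k : ℕ), Hist S.P k → Set (PBond S.P k))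
    (𝔖 : ∀ (S : Scales F.L) (k : ℕ), StepSeries S (Matrix.specialUnitaryGroup (Fin 2) ℂ) ↥(lieC (suGroupModel 2)) (nblkOf S (bump68 𝔠₀).lane.carrier k) k)
    (𝔄 : ∀ S : Scales F.L, AlphaData (suGroupModel 2) (bump68 𝔠₀)
      (XeOf (suGroupModel 2) (bump68 𝔠₀) X₀ hstd w (suDir_mem_su le_rfl) (suDir_ne_zero le_rfl) (four_pi_le_regMin_bump68 𝔠₀) Bk S) (𝔖 S))
    (coef : ∀ (S : Scales F.L) (k : ℕ), Hist S.P (k + 1) → GaugeField S.P (k + 1) (Matrix.specialUnitaryGroup (Fin 2) ℂ) → (j : ℕ) → TermSizes (oldGeom S.P k j))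
    (hD : ∀ S : Scales F.L, S.g ^ 2 * S.ε₀ ≤ (min (gammaN08d (bump68 𝔠₀)) 1) ^ 2 →
      RunDataRows (suGroupModel 2) (bump68 𝔠₀)
        (XeOf (suGroupModel 2) (bump68 𝔠₀) X₀ hstd w (suDir_mem_su le_rfl) (suDir_ne_zero le_rfl) (four_pi_le_regMin_bump68 𝔠₀) Bk S) (𝔖 S) (𝔄 S)
        (sizesOf (suGroupModel 2) (bump68 𝔠₀)
          (XeOf (suGroupModel 2) (bump68 𝔠₀) X₀ hstd w (suDir_mem_su le_rfl) (suDir_ne_zero le_rfl) (four_pi_le_regMin_bump68 𝔠₀) Bk S) (coef S))) :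
    ∃ (θ : Stage13Params F 2) (h : θ.Provisos₁₃Core F 2) (w' : WorldP), (θ.ZtUnity F 2 ∧ θ.SlotsNondegenerate₁₃ F 2) ∧ θ.Admissible F 2 ∧
      IsRecordOfRecord₁₃CCoP F 2 (datumOfRecord₁₃CoP F 2 θ h) w' ∧ ∀ P : B12.RunParams, Dag.B10_main (leavesP w' P) :=
  exists_guarded_record₁₃CCoP_laneXeOf_b10_main_of_data_su_bump le_rfl _ hP (admissible_theta13LiveOfNumerics F 2 _ _ _ hn hε')
    ⟨ztUnity_theta13LiveOfNumerics F 2 n ε₂₉, slotsNondegenerate₁₃_theta13LiveOfNumerics_of_hasResiduals F 2 n ε₂₉⟩ 𝔠₀ X₀ hstd w Bk 𝔖 𝔄 coef hD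

end Numerics

end Summit.QuantumFields.YangMills.BalabanUVNodes.N08AtRecord13CoPLaneXeOf

end
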